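import Summits.QuantumFields.YangMills.Theorems.PencilRigidityHypercubicLimitDefs
import Summits.QuantumFields.YangMills.Theorems.PencilRigidityHypercubicLimitScaledShiftedBound
import Literature.MathematicalPhysics.QuantumLattice.LatticeGaugeDLRCovarianceSplit
import HarnessLib

/-!
# Crux `HypercubicLimit` (stmt-QuantumFields-16154), line `peel-and-disseminate` (c1 seat): the uniform bound (U)

Support file (`--supports stmt-QuantumFields-16154`) proving the registered sub-goal `stub_uniformBoundPeeled` of
the line `peel-and-disseminate` (skeleton `Cruxes/HypercubicLimit/Lines/peel_and_disseminate.lean`, §3):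
λ-Gaussian domination of separated centred plaquette moments (exponent `γ = 0`, window radius tied to the
separation radius by the blow-up factor, `λR' ≤ R`) + (W2) `WindowRegularity` ⇒ the host's (U) `UniformBound`
(the a-uniform E0′-type bound, units `a = m(β)`, on the RP-normalised plane-string lattice distributions at shifted
evaluation points).  Route: instantiate the landed abstract three-zone bound `stub_scaledShiftedBound` (p122873)
with `W x := planeWeight r β S q x` — the centred `torusPlaquette`-string moment (`planeWeight_eq_integral_prod`:
`plaquetteObs ρ 0 i j (τ₋ₓ V) = plaquetteObs ρ x i j V` and translation invariance of the torus means
`integral_comp_configShift_torusLift`) — sup bound `M := 2N` (`abs_centred_torusPlaquette_le`), window `δ₀`,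
height `R₀ := ⌊δ₀/a⌋`, exponents `P = E := p + q`; the separated-zone hypothesis `|W x| ≤ (B (R₀/ρ)^P)ⁿ`
(`(2ρ+1)`-separated, `1 ≤ ρ ≤ R₀`) comes for `ρ ≥ λ` from the λ-domination at `R' := ρ/λ` (`λR' ≤ ρ < λ(R'+1)`)
and the doubling (W2)(a) (`uniformBound_far_zone_arith`), for `ρ < λ` from the sup bound
(`uniformBound_near_zone_arith`), the part `2N (λ/R₀)^P` of `B` being `O(a^P) = O(√N)` by the floor (W2)(c) and
doubling (`uniformBound_norm_arith`: `N = A(R₀) ≥ a^{p+q}/(C_W δ₀^p) > 0`; `uniformBound_tail_arith`); the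
smallness of `a = m(β)` (`a ≤ 1/24`, `a ≤ δ₀/2`) from `m → 0` (`GapData` (ii)).  Refs: OsterwalderSchrader1975 §2
(E0′); GlimmJaffe1987 §6.1; card `Cruxes/HypercubicLimit/Ideas/peel-and-disseminate.md`.
-/

set_option autoImplicit false

noncomputable section

open scoped SchwartzMap ENNReal
open MeasureTheory Filter Topology
open Literature.MathematicalPhysics.AQFT Literature.MathematicalPhysics.QuantumLattice
open Literature.MathematicalPhysics.QuantumFieldTheory
open Literature.Probability.LatticeModels (box Site)
open Summit.QuantumFields.YangMills.Theorems.HypercubicLimit.Negative (torusPlaquette rpSquare)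
open Summit.QuantumFields.YangMills.Cruxes.HypercubicLimit.ConditionalMeanTelescoping
  (GapData WindowRegularity UniformBound refSquare planeWeight planeObs)

namespace Summit.QuantumFields.YangMills.Cruxes.HypercubicLimit.PeelAndDisseminate

section Bridge

variable {G : Type} [Group G] [TopologicalSpace G] [IsTopologicalGroup G] [CompactSpace G]
  [MeasurableSpace G] [BorelSpace G]

omit [TopologicalSpace G] [IsTopologicalGroup G] [CompactSpace G] [BorelSpace G] in
-- adapted from `CurvatureBoostCovariance.Negative.plaquetteObs_configShift_torusLift` (BetaZeroMoments.lean)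
/-- The plaquette field based at the origin, read on the configuration translated by `-x`, is the plaquette field
based at `x`: `p_{ij}(0)(τ₋ₓ V) = p_{ij}(x)(V)`. [folklore] -/
theorem plaquetteObs_zero_configShift_neg {N : ℕ} (ρ : G →* Matrix (Fin N) (Fin N) ℂ) (x : Site 4)
    (i j : Fin 4) (V : LGConfig 4 G) :
    plaquetteObs ρ 0 i j (configShift (-x) V) = plaquetteObs ρ x i j V := by
  simp only [plaquetteObs, plaquetteHolonomyZd, configShift_apply, sub_neg_eq_add, zero_add,
    add_comm (Pi.single _ _) x]

/-- **Bridge**: the plane-string weight `planeWeight r β S q x` (the sibling crux's `torusMomentStr` of the string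
`planeObs ∘ q`, centred by the torus Wilson means) is the torus moment of the centred plaquettes
`∫ ∏ₖ (p_{qₖ}(xₖ) − ⟨p_{qₖ}(xₖ)⟩) dμ_{β,2S+1}` (translation invariance of the torus means). [folklore] -/
theorem planeWeight_eq_integral_prod (r : LatticeRep G) (β : ℝ) (S : ℕ) {n : ℕ}
    (q : Fin n → Fin 4 × Fin 4) (x : Fin n → Site 4) :
    planeWeight r β S q x =
      ∫ U, ∏ k, (torusPlaquette r (2 * S + 1) (q k).1 (q k).2 (x k) U -
          ∫ V, torusPlaquette r (2 * S + 1) (q k).1 (q k).2 (x k) V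
            ∂(wilsonMeasure r.ρ β : Measure (GaugeConfig 4 (2 * S + 1) G)))
        ∂(wilsonMeasure r.ρ β : Measure (GaugeConfig 4 (2 * S + 1) G)) := by
  unfold planeWeight Summit.QuantumFields.YangMills.Theorems.OSLegsFromFemtoAndGap.torusMomentStr
  refine integral_congr_ae (Eventually.of_forall fun U => ?_)
  refine Finset.prod_congr rfl fun k _ => ?_
  have h1 : planeObs r (q k) (configShift (-(x k)) (torusLift (2 * S + 1) U)) =
      torusPlaquette r (2 * S + 1) (q k).1 (q k).2 (x k) U := by
    unfold planeObs torusPlaquette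
    exact plaquetteObs_zero_configShift_neg r.ρ (x k) (q k).1 (q k).2 _
  have h2 : wilsonTorusMean r.ρ β S (planeObs r (q k)) =
      ∫ V, torusPlaquette r (2 * S + 1) (q k).1 (q k).2 (x k) V
        ∂(wilsonMeasure r.ρ β : Measure (GaugeConfig 4 (2 * S + 1) G)) := by
    unfold wilsonTorusMean
    rw [← integral_comp_configShift_torusLift r.ρ β (planeObs r (q k)) (-(x k))]
    refine integral_congr_ae (Eventually.of_forall fun V => ?_)
    unfold planeObs torusPlaquette
    exact plaquetteObs_zero_configShift_neg r.ρ (x k) (q k).1 (q k).2 _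
  beta_reduce
  rw [h1, h2]

/-- **Sup bound**: the torus moment of `n` centred plaquettes is at most `(2N)ⁿ` in absolute value (each centred
plaquette factor is bounded by `2N`, Wilson's measure is a probability measure). [folklore] -/
theorem abs_integral_prod_centred_torusPlaquette_le (r : LatticeRep G) (β : ℝ) (S : ℕ) {n : ℕ}
    (q : Fin n → Fin 4 × Fin 4) (x : Fin n → Site 4) :
    |∫ U, ∏ k, (torusPlaquette r (2 * S + 1) (q k).1 (q k).2 (x k) U -
          ∫ V, torusPlaquette r (2 * S + 1) (q k).1 (q k).2 (x k) V
            ∂(wilsonMeasure r.ρ β : Measure (GaugeConfig 4 (2 * S + 1) G)))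
        ∂(wilsonMeasure r.ρ β : Measure (GaugeConfig 4 (2 * S + 1) G))| ≤ (2 * r.N) ^ n := by
  haveI := isProbabilityMeasure_wilsonMeasure (d := 4) (L := 2 * S + 1) r.ρ r.continuous β
  have hpt : ∀ U : GaugeConfig 4 (2 * S + 1) G,
      ‖∏ k, (torusPlaquette r (2 * S + 1) (q k).1 (q k).2 (x k) U -
          ∫ V, torusPlaquette r (2 * S + 1) (q k).1 (q k).2 (x k) V
            ∂(wilsonMeasure r.ρ β : Measure (GaugeConfig 4 (2 * S + 1) G)))‖ ≤ (2 * r.N) ^ n := by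
    intro U
    rw [Real.norm_eq_abs, Finset.abs_prod]
    refine (Finset.prod_le_prod (fun k _ => abs_nonneg _) fun k _ =>
      Summit.QuantumFields.YangMills.Theorems.HypercubicLimit.Negative.abs_centred_torusPlaquette_le
        r _ _ _ _ _ U).trans_eq ?_
    rw [Finset.prod_const, Finset.card_univ, Fintype.card_fin]
  rw [← Real.norm_eq_abs]
  refine (norm_integral_le_of_norm_le_const (Eventually.of_forall hpt)).trans_eq ?_
  rw [probReal_univ, mul_one]

end Bridge

/-! ## Arithmetic of the instantiation (small contexts) -/

section Arithmetic

/-- **Normalisation arithmetic**: from the floor `a^q ≤ A(1)`, the doubling inequalities `A(1) ≤ C_W A(1)` and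
`A(1) ≤ C_W R₀^p N`, and `R₀ ≤ δ₀/a`: `C_W > 0`, `N > 0` and `a^{p+q} ≤ √(C_W δ₀^p) √N`. [folklore] -/
theorem uniformBound_norm_arith {a δ₀ CW A1 N : ℝ} {p q R₀ : ℕ} (ha : 0 < a) (ha1 : a ≤ 1) (hδ₀ : 0 < δ₀)
    (hR₀le : (R₀ : ℝ) ≤ δ₀ / a) (hfloor : a ^ q ≤ A1) (hdb11 : A1 ≤ CW * A1)
    (hdb1 : A1 ≤ CW * (R₀ : ℝ) ^ p * N) :
    0 < CW ∧ 0 < N ∧ a ^ (p + q) ≤ Real.sqrt (CW * δ₀ ^ p) * Real.sqrt N := by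
  have hA1pos : 0 < A1 := lt_of_lt_of_le (pow_pos ha q) hfloor
  have hCW1 : 1 ≤ CW := by
    by_contra hlt
    push Not at hlt
    have : CW * A1 < 1 * A1 := mul_lt_mul_of_pos_right hlt hA1pos
    linarith
  have hCW0 : 0 < CW := by linarith
  have hNpos : 0 < N := by
    by_contra hle
    push Not at hle
    have h1 : CW * (R₀ : ℝ) ^ p * N ≤ 0 := mul_nonpos_of_nonneg_of_nonpos (by positivity) hle
    linarith
  have hNlow : a ^ (p + q) ≤ CW * δ₀ ^ p * N := by
    have h1 : a ^ q ≤ CW * (R₀ : ℝ) ^ p * N := hfloor.trans hdb1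
    calc a ^ (p + q) = a ^ p * a ^ q := pow_add _ _ _
      _ ≤ a ^ p * (CW * (R₀ : ℝ) ^ p * N) := mul_le_mul_of_nonneg_left h1 (by positivity)
      _ ≤ a ^ p * (CW * (δ₀ / a) ^ p * N) := by gcongr
      _ = CW * δ₀ ^ p * N * (a ^ p / a ^ p) := by rw [div_pow]; ring
      _ = CW * δ₀ ^ p * N := by rw [div_self (pow_ne_zero _ ha.ne'), mul_one]
  refine ⟨hCW0, hNpos, ?_⟩
  rw [← Real.sqrt_mul (by positivity)]
  refine Real.le_sqrt_of_sq_le ?_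
  have hapq1 : a ^ (p + q) ≤ 1 := pow_le_one₀ ha.le ha1
  calc (a ^ (p + q)) ^ 2 = a ^ (p + q) * a ^ (p + q) := sq _
    _ ≤ 1 * a ^ (p + q) := mul_le_mul_of_nonneg_right hapq1 (by positivity)
    _ ≤ CW * δ₀ ^ p * N := by rw [one_mul]; exact hNlow

/-- **Far-zone arithmetic**: the λ-domination value `(C √A(R'))ⁿ` at `R' = ρ/λ` (`ρ < λ(R'+1)`), with the doubling
`A(R') ≤ C_W (R₀/R')^p N`, is at most `(|C| √C_W (2λ)^p √N (R₀/ρ)^{p+q})ⁿ`. [folklore] -/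
theorem uniformBound_far_zone_arith {C CW N A t : ℝ} {lam ρ R' R₀ p q n : ℕ} (hCW : 0 ≤ CW)
    (hR'1 : 1 ≤ R') (hρ : ρ < lam * (R' + 1)) (hR'R₀ : R' ≤ R₀) (hρR₀ : ρ ≤ R₀) (hρ1 : 1 ≤ ρ)
    (ht : t ≤ (C * Real.sqrt A) ^ n) (hA : A ≤ CW * ((R₀ : ℝ) / R') ^ p * N) :
    t ≤ (|C| * Real.sqrt CW * (2 * lam) ^ p * Real.sqrt N * ((R₀ : ℝ) / ρ) ^ (p + q)) ^ n := by
  have hρpos : (0 : ℝ) < ρ := by exact_mod_cast hρ1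
  have hR'pos : (0 : ℝ) < R' := by exact_mod_cast hR'1
  have hlam0 : (0 : ℝ) ≤ lam := Nat.cast_nonneg lam
  have hR₀ρ : 1 ≤ (R₀ : ℝ) / ρ := by rw [le_div_iff₀ hρpos, one_mul]; exact_mod_cast hρR₀
  have hR₀R' : 1 ≤ (R₀ : ℝ) / R' := by rw [le_div_iff₀ hR'pos, one_mul]; exact_mod_cast hR'R₀
  have hρle : (ρ : ℝ) ≤ 2 * lam * R' := by
    have h2 : (ρ : ℝ) + 1 ≤ lam * (R' + 1) := by exact_mod_cast Nat.succ_le_of_lt hρ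
    have h3 : (1 : ℝ) ≤ R' := by exact_mod_cast hR'1
    have h4 : (lam : ℝ) ≤ lam * R' := le_mul_of_one_le_right hlam0 h3
    linarith
  have hratio : (R₀ : ℝ) / R' ≤ 2 * lam * ((R₀ : ℝ) / ρ) := by
    rw [div_le_iff₀ hR'pos]
    calc (R₀ : ℝ) = R₀ / ρ * ρ := (div_mul_cancel₀ _ hρpos.ne').symm
      _ ≤ R₀ / ρ * (2 * lam * R') := mul_le_mul_of_nonneg_left hρle (by positivity)
      _ = 2 * lam * ((R₀ : ℝ) / ρ) * R' := by ring
  have hsq : Real.sqrt A ≤ Real.sqrt CW * (2 * lam) ^ p * Real.sqrt N * ((R₀ : ℝ) / ρ) ^ (p + q) := by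
    calc Real.sqrt A ≤ Real.sqrt (CW * ((R₀ : ℝ) / R') ^ p * N) := Real.sqrt_le_sqrt hA
      _ = Real.sqrt CW * Real.sqrt (((R₀ : ℝ) / R') ^ p) * Real.sqrt N := by
          rw [Real.sqrt_mul (by positivity), Real.sqrt_mul hCW]
      _ ≤ Real.sqrt CW * ((R₀ : ℝ) / R') ^ p * Real.sqrt N := by
          gcongr
          exact (Real.sqrt_le_left (by positivity)).2 (le_self_pow₀ (one_le_pow₀ hR₀R') two_ne_zero)
      _ ≤ Real.sqrt CW * (2 * lam * ((R₀ : ℝ) / ρ)) ^ p * Real.sqrt N := by gcongr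
      _ = Real.sqrt CW * (2 * lam) ^ p * Real.sqrt N * ((R₀ : ℝ) / ρ) ^ p := by rw [mul_pow]; ring
      _ ≤ Real.sqrt CW * (2 * lam) ^ p * Real.sqrt N * ((R₀ : ℝ) / ρ) ^ (p + q) :=
          mul_le_mul_of_nonneg_left (pow_le_pow_right₀ hR₀ρ (Nat.le_add_right p q)) (by positivity)
  calc t ≤ (C * Real.sqrt A) ^ n := ht
    _ ≤ |C * Real.sqrt A| ^ n := by rw [← abs_pow]; exact le_abs_self _
    _ = (|C| * Real.sqrt A) ^ n := by rw [abs_mul, abs_of_nonneg (Real.sqrt_nonneg _)]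
    _ ≤ (|C| * (Real.sqrt CW * (2 * lam) ^ p * Real.sqrt N * ((R₀ : ℝ) / ρ) ^ (p + q))) ^ n := by gcongr
    _ = _ := by ring

/-- **Near-zone arithmetic**: for `1 ≤ ρ ≤ λ` the sup bound `Mⁿ` is below `((B₁ + M (λ/R₀)^P) (R₀/ρ)^P)ⁿ`.
[folklore] -/
theorem uniformBound_near_zone_arith {M B₁ : ℝ} {lam ρ R₀ P : ℕ} (hM : 0 ≤ M) (hB₁ : 0 ≤ B₁)
    (hρ1 : 1 ≤ ρ) (hρlam : ρ ≤ lam) (hR₀ : 1 ≤ R₀) (n : ℕ) :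
    M ^ n ≤ ((B₁ + M * ((lam : ℝ) / R₀) ^ P) * ((R₀ : ℝ) / ρ) ^ P) ^ n := by
  have hρpos : (0 : ℝ) < ρ := by exact_mod_cast hρ1
  have hR₀pos : (0 : ℝ) < R₀ := by exact_mod_cast hR₀
  have hlam0 : (0 : ℝ) < lam := by exact_mod_cast (hρ1.trans hρlam : 0 < lam)
  refine pow_le_pow_left₀ hM ?_ n
  have h1 : M = M * ((lam : ℝ) / R₀) ^ P * ((R₀ : ℝ) / lam) ^ P := by
    rw [mul_assoc, ← mul_pow, div_mul_div_comm, mul_comm (lam : ℝ) R₀,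
      div_self (mul_pos hR₀pos hlam0).ne', one_pow, mul_one]
  have h2 : ((R₀ : ℝ) / lam) ^ P ≤ ((R₀ : ℝ) / ρ) ^ P :=
    pow_le_pow_left₀ (by positivity)
      (div_le_div_of_nonneg_left hR₀pos.le hρpos (by exact_mod_cast hρlam)) _
  have hB₂0 : 0 ≤ M * ((lam : ℝ) / R₀) ^ P := by positivity
  calc M = M * ((lam : ℝ) / R₀) ^ P * ((R₀ : ℝ) / lam) ^ P := h1
    _ ≤ M * ((lam : ℝ) / R₀) ^ P * ((R₀ : ℝ) / ρ) ^ P := mul_le_mul_of_nonneg_left h2 hB₂0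
    _ ≤ (B₁ + M * ((lam : ℝ) / R₀) ^ P) * ((R₀ : ℝ) / ρ) ^ P :=
        mul_le_mul_of_nonneg_right (by linarith) (by positivity)

/-- **Tail arithmetic**: `K₀ⁿ (Bⁿ + Mⁿ a^{(p+q)n}) ≤ (K √N)ⁿ` once `B = B₁ + B₂`, `B₁ = A √N`, `B₂ = M l^{p+q}`,
`l ≤ c a` and `a^{p+q} ≤ κ √N`, with `K = K₀ (A + M c^{p+q} κ + M κ)` (exponent `γ = 0`). [folklore] -/
theorem uniformBound_tail_arith {K₀ B₁ B₂ M a κ N A l c sN X : ℝ} {n p q : ℕ} (hn : n ≠ 0)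
    (hK₀ : 0 ≤ K₀) (hM : 0 ≤ M) (ha : 0 ≤ a) (hκ : 0 ≤ κ) (hA : 0 ≤ A) (hc : 0 ≤ c) (hl0 : 0 ≤ l) (hsN : 0 ≤ sN)
    (hB₁ : B₁ = A * Real.sqrt N) (hB₂ : B₂ = M * l ^ (p + q)) (hl : l ≤ c * a)
    (haκ : a ^ (p + q) ≤ κ * Real.sqrt N)
    (hX : X ≤ K₀ ^ n * ((B₁ + B₂) ^ n + M ^ n * a ^ ((p + q) * n)) * sN) :
    X ≤ (K₀ * (A + M * c ^ (p + q) * κ + M * κ) * (n : ℝ) ^ 0 * Real.sqrt N) ^ n * sN := by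
  have hB₂le : B₂ ≤ M * c ^ (p + q) * κ * Real.sqrt N := by
    calc B₂ = M * l ^ (p + q) := hB₂
      _ ≤ M * (c * a) ^ (p + q) := mul_le_mul_of_nonneg_left (pow_le_pow_left₀ hl0 hl _) hM
      _ = M * (c ^ (p + q) * a ^ (p + q)) := by rw [← mul_pow]
      _ ≤ M * (c ^ (p + q) * (κ * Real.sqrt N)) :=
          mul_le_mul_of_nonneg_left (mul_le_mul_of_nonneg_left haκ (by positivity)) hM
      _ = M * c ^ (p + q) * κ * Real.sqrt N := by rw [← mul_assoc, ← mul_assoc]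
  have hB₁0 : 0 ≤ B₁ := by rw [hB₁]; positivity
  have hB₂0 : 0 ≤ B₂ := by rw [hB₂]; positivity
  have hBle : B₁ + B₂ ≤ (A + M * c ^ (p + q) * κ) * Real.sqrt N := by
    rw [add_mul]; exact add_le_add hB₁.le hB₂le
  have hMa : M * a ^ (p + q) ≤ M * κ * Real.sqrt N :=
    calc M * a ^ (p + q) ≤ M * (κ * Real.sqrt N) := mul_le_mul_of_nonneg_left haκ hM
      _ = M * κ * Real.sqrt N := (mul_assoc _ _ _).symm
  have hsum : (B₁ + B₂) ^ n + M ^ n * a ^ ((p + q) * n) ≤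
      ((A + M * c ^ (p + q) * κ + M * κ) * Real.sqrt N) ^ n := by
    calc (B₁ + B₂) ^ n + M ^ n * a ^ ((p + q) * n)
        = (B₁ + B₂) ^ n + (M * a ^ (p + q)) ^ n := by rw [pow_mul, ← mul_pow]
      _ ≤ ((A + M * c ^ (p + q) * κ) * Real.sqrt N) ^ n + (M * κ * Real.sqrt N) ^ n :=
          add_le_add (pow_le_pow_left₀ (by positivity) hBle n) (pow_le_pow_left₀ (by positivity) hMa n)
      _ ≤ ((A + M * c ^ (p + q) * κ) * Real.sqrt N + M * κ * Real.sqrt N) ^ n :=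
          pow_add_pow_le (by positivity) (by positivity) hn
      _ = _ := by rw [← add_mul]
  calc X ≤ K₀ ^ n * ((B₁ + B₂) ^ n + M ^ n * a ^ ((p + q) * n)) * sN := hX
    _ ≤ K₀ ^ n * ((A + M * c ^ (p + q) * κ + M * κ) * Real.sqrt N) ^ n * sN :=
        mul_le_mul_of_nonneg_right (mul_le_mul_of_nonneg_left hsum (pow_nonneg hK₀ n)) hsN
    _ = (K₀ * (A + M * c ^ (p + q) * κ + M * κ) * (n : ℝ) ^ 0 * Real.sqrt N) ^ n * sN := by
        rw [pow_zero, mul_one, ← mul_pow, mul_assoc K₀]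

end Arithmetic

/-- **stub_uniformBoundPeeled** (registered sub-goal of crux stmt-QuantumFields-16154, line `peel-and-disseminate`
§3): λ-Gaussian domination + (W2) window regularity ⇒ the host's (U) `UniformBound` (a-uniform E0′-type bound on
the RP-normalised plane-string distributions at shifted points, units `a = m(β)`, normalisation `N = rpSquare` at
height `R₀ = ⌊δ₀/a⌋`).  Route: the landed abstract three-zone bound `stub_scaledShiftedBound` fed with
`W x := planeWeight r β S q x` (`planeWeight_eq_integral_prod`), `M := 2N`, window `δ₀`, `P = E := p + q`; its
separated-zone hypothesis comes for `ρ ≥ λ` from the λ-domination at `R' := ρ/λ` and (W2)(a) doubling, and for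
`ρ < λ` from the sup bound, the extra part `2N (λ/R₀)^P` of `B` being `≤ const · √N` by the floor (W2)(c);
`γ := 0`. [folklore] -/
theorem stub_uniformBoundPeeled :
    (∀ (G : Type) [Group G] [TopologicalSpace G] [IsTopologicalGroup G] [CompactSpace G]
      [MeasurableSpace G] [BorelSpace G], IsCompactSimpleLieGroup G →
      ∀ (r : LatticeRep G) (β₁ C₁ c₂ : ℝ) (m : ℝ → ℝ), GapData G r β₁ C₁ c₂ m →
        ∀ c₀ : ℝ, 0 < c₀ → ∃ (lam : ℕ) (C β₀ : ℝ), 1 ≤ lam ∧ ∀ β : ℝ, β₀ ≤ β → ∀ n : ℕ, 2 ≤ n →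
          ∃ S₀ : ℕ, ∀ S : ℕ, S₀ ≤ S →
            ∀ (R R' : ℕ) (o : Fin n → Fin 4 × Fin 4) (x : Fin n → Site 4),
              (∀ k, (o k).1 ≠ (o k).2) → 1 ≤ R' → lam * R' ≤ R → (R' : ℝ) ≤ c₀ / m β →
              4 * R + 4 < 2 * S + 1 →
              (∀ k l, k ≠ l → ∃ μ : Fin 4, (2 * R + 1 : ℤ) < |x k μ - x l μ| ∧ |x k μ - x l μ| ≤ S) →
                |∫ U, ∏ k, (torusPlaquette r (2 * S + 1) (o k).1 (o k).2 (x k) U -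
                      ∫ V, torusPlaquette r (2 * S + 1) (o k).1 (o k).2 (x k) V
                        ∂(wilsonMeasure r.ρ β : Measure (GaugeConfig 4 (2 * S + 1) G)))
                    ∂(wilsonMeasure r.ρ β : Measure (GaugeConfig 4 (2 * S + 1) G))| ≤
                  (C * Real.sqrt (rpSquare r β S R')) ^ n) →
    WindowRegularity → UniformBound := by
  intro hGD hWR G _ _ _ _ _ _ hG r β₁ C₁ c₂ m hgap δ₀ hδ₀
  -- the three inputs at window `c₀ := δ₀`
  obtain ⟨lam, C, βG, hlam, hGD'⟩ := hGD G hG r β₁ C₁ c₂ m hgap δ₀ hδ₀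
  obtain ⟨CW, c, θ, βW, p, q, _hc, _hθ, hWR'⟩ := hWR G hG r β₁ C₁ c₂ m hgap δ₀ hδ₀
  obtain ⟨K₀, s, hK₀, hSSB⟩ :=
    Summit.QuantumFields.YangMills.Cruxes.HypercubicLimit.ConditionalMeanTelescoping.stub_scaledShiftedBound
      δ₀ hδ₀ (p + q) (p + q)
  obtain ⟨hm_pos, hm_tendsto, -, -, -⟩ := hgap
  -- smallness threshold for `a = m β`
  obtain ⟨β₂, hβ₂⟩ : ∃ β₂ : ℝ, ∀ β, β₂ ≤ β → m β < min (1 / 24) (δ₀ / 2) := by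
    have hε0 : (0 : ℝ) < min (1 / 24) (δ₀ / 2) := lt_min (by norm_num) (by linarith)
    exact Filter.eventually_atTop.1 (hm_tendsto.eventually (gt_mem_nhds hε0))
  -- constants
  have hlam0 : (0 : ℝ) < lam := by exact_mod_cast (show 0 < lam by omega)
  obtain ⟨M, hM⟩ : ∃ M : ℝ, M = 2 * r.N := ⟨_, rfl⟩
  have hM0 : 0 ≤ M := by rw [hM]; positivity
  refine ⟨K₀ * (|C| * Real.sqrt |CW| * (2 * lam) ^ p +
      M * (2 * lam / δ₀) ^ (p + q) * Real.sqrt (|CW| * δ₀ ^ p) + M * Real.sqrt (|CW| * δ₀ ^ p)),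
    max (max β₁ β₂) (max βG βW), 0, s, ?_⟩
  intro β hβ n hn
  have hβ1 : β₁ ≤ β := le_trans (le_max_left _ _) (le_trans (le_max_left _ _) hβ)
  have hβ2 : β₂ ≤ β := le_trans (le_max_right _ _) (le_trans (le_max_left _ _) hβ)
  have hβG : βG ≤ β := le_trans (le_max_left _ _) (le_trans (le_max_right _ _) hβ)
  have hβW : βW ≤ β := le_trans (le_max_right _ _) (le_trans (le_max_right _ _) hβ)
  have hn0 : n ≠ 0 := by omega
  -- the unit `a = m β`
  have ha : 0 < m β := hm_pos β hβ1
  have haε : m β < min (1 / 24) (δ₀ / 2) := hβ₂ β hβ2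
  have ha24 : m β ≤ 1 / 24 := (haε.trans_le (min_le_left _ _)).le
  have haδ : m β ≤ δ₀ / 2 := (haε.trans_le (min_le_right _ _)).le
  have ha1 : m β ≤ 1 := ha24.trans (by norm_num)
  -- the normalisation height `R₀ = ⌊δ₀ / a⌋`
  set R₀ : ℕ := ⌊δ₀ / m β⌋₊ with hR₀
  have hR₀le : (R₀ : ℝ) ≤ δ₀ / m β := Nat.floor_le (by positivity)
  have hR₀gt : δ₀ / m β - 1 < R₀ := by
    have := Nat.lt_floor_add_one (δ₀ / m β); rw [← hR₀] at this; linarith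
  have h2a : 2 ≤ δ₀ / m β := by rw [le_div_iff₀ ha]; linarith
  have hR₀1r : (1 : ℝ) ≤ R₀ := by linarith
  have hR₀1 : 1 ≤ R₀ := by exact_mod_cast hR₀1r
  have hR₀a : (R₀ : ℝ) * m β ≤ δ₀ := by rwa [← le_div_iff₀ ha]
  have hR₀half : δ₀ / (2 * m β) ≤ R₀ := by
    have : δ₀ / (2 * m β) = δ₀ / m β / 2 := by ring
    rw [this]; linarith
  have hlamR₀ : (lam : ℝ) / R₀ ≤ 2 * lam / δ₀ * m β := by
    calc (lam : ℝ) / R₀ ≤ lam / (δ₀ / (2 * m β)) :=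
          div_le_div_of_nonneg_left hlam0.le (by positivity) hR₀half
      _ = 2 * lam / δ₀ * m β := by rw [div_div_eq_mul_div]; ring
  -- the torus threshold
  obtain ⟨SG, hSG⟩ := hGD' β hβG n hn
  obtain ⟨SW, hSW⟩ := hWR' β hβW
  refine ⟨max (max SG SW) (max ⌈(m β)⁻¹ * (m β)⁻¹⌉₊ (2 * R₀ + 2)), ?_⟩
  intro S hS
  have hSG' : SG ≤ S := le_trans (le_max_left _ _) (le_trans (le_max_left _ _) hS)
  have hSW' : SW ≤ S := le_trans (le_max_right _ _) (le_trans (le_max_left _ _) hS)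
  have hSa' : ⌈(m β)⁻¹ * (m β)⁻¹⌉₊ ≤ S := le_trans (le_max_left _ _) (le_trans (le_max_right _ _) hS)
  have hSR' : 2 * R₀ + 2 ≤ S := le_trans (le_max_right _ _) (le_trans (le_max_right _ _) hS)
  have hSa : (m β)⁻¹ * (m β)⁻¹ ≤ (S : ℝ) := (Nat.le_ceil _).trans (by exact_mod_cast hSa')
  have hSR : 4 * R₀ + 4 < 2 * S + 1 := by omega
  obtain ⟨hdbl, -, hfloor⟩ := hSW S hSW'
  -- the normalisation `N = A(R₀)`: positivity and the polynomial lower bound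
  have hNdef : refSquare r β S δ₀ (m β) = rpSquare r β S R₀ := rfl
  rw [hNdef]
  set N : ℝ := rpSquare r β S R₀ with hN
  have h1w : ((1 : ℕ) : ℝ) ≤ δ₀ / m β := by rw [Nat.cast_one]; linarith
  have hdb11 : rpSquare r β S 1 ≤ CW * rpSquare r β S 1 := by
    have h := hdbl 1 1 le_rfl le_rfl h1w
    simpa only [Nat.cast_one, div_one, one_pow, mul_one] using h
  have hdb1 : rpSquare r β S 1 ≤ CW * (R₀ : ℝ) ^ p * N := by
    have h := hdbl 1 R₀ le_rfl hR₀1 hR₀le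
    rwa [Nat.cast_one, div_one] at h
  obtain ⟨hCW0, hNpos, hκN'⟩ := uniformBound_norm_arith ha ha1 hδ₀ hR₀le hfloor hdb11 hdb1
  have hCWabs : |CW| = CW := abs_of_pos hCW0
  rw [hCWabs]
  obtain ⟨κ, hκ⟩ : ∃ κ : ℝ, κ = Real.sqrt (CW * δ₀ ^ p) := ⟨_, rfl⟩
  rw [← hκ]
  have hκ0 : 0 ≤ κ := by rw [hκ]; exact Real.sqrt_nonneg _
  have hκN : m β ^ (p + q) ≤ κ * Real.sqrt N := by rw [hκ]; exact hκN'
  refine ⟨hNpos, ?_⟩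
  intro qo hqo y hy F hF
  -- the weights and their two bounds
  set W : (Fin n → Site 4) → ℝ := fun x => planeWeight r β S qo x with hW
  have hWeq : ∀ x, W x = ∫ U, ∏ k, (torusPlaquette r (2 * S + 1) (qo k).1 (qo k).2 (x k) U -
      ∫ V, torusPlaquette r (2 * S + 1) (qo k).1 (qo k).2 (x k) V
        ∂(wilsonMeasure r.ρ β : Measure (GaugeConfig 4 (2 * S + 1) G)))
      ∂(wilsonMeasure r.ρ β : Measure (GaugeConfig 4 (2 * S + 1) G)) :=
    fun x => planeWeight_eq_integral_prod r β S qo x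
  have hWsup : ∀ x, |W x| ≤ M ^ n := fun x => by
    rw [hWeq x, hM]; exact abs_integral_prod_centred_torusPlaquette_le r β S qo x
  set B₁ : ℝ := |C| * Real.sqrt CW * (2 * lam) ^ p * Real.sqrt N with hB₁
  set B₂ : ℝ := M * ((lam : ℝ) / R₀) ^ (p + q) with hB₂
  have hB₁0 : 0 ≤ B₁ := by rw [hB₁]; positivity
  have hB₂0 : 0 ≤ B₂ := by rw [hB₂]; positivity
  have hWsep : ∀ x ∈ Fintype.piFinset (fun _ : Fin n => box 4 S), ∀ R : ℕ, 1 ≤ R → R ≤ R₀ →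
      (∀ k l : Fin n, k ≠ l → ∃ μ : Fin 4, (2 * R + 1 : ℤ) < |x k μ - x l μ| ∧ |x k μ - x l μ| ≤ S) →
        |W x| ≤ ((B₁ + B₂) * ((R₀ : ℝ) / R) ^ (p + q)) ^ n := by
    intro x _ ρ hρ1 hρR₀ hsep
    by_cases hlamρ : lam ≤ ρ
    · -- separated far zone: the λ-domination at `R' := ρ / λ` and doubling
      have hR'1 : 1 ≤ ρ / lam := (Nat.le_div_iff_mul_le (by omega)).2 (by simpa using hlamρ)
      have hlamR' : lam * (ρ / lam) ≤ ρ := Nat.mul_div_le ρ lam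
      have hR'ρ : ρ / lam ≤ ρ := Nat.div_le_self ρ lam
      have hR'w : ((ρ / lam : ℕ) : ℝ) ≤ δ₀ / m β :=
        le_trans (by exact_mod_cast hR'ρ.trans hρR₀) hR₀le
      have h4 : 4 * ρ + 4 < 2 * S + 1 := by omega
      have hdom := hSG S hSG' ρ (ρ / lam) qo x hqo hR'1 hlamR' hR'w h4 hsep
      have hAR' : rpSquare r β S (ρ / lam) ≤ CW * ((R₀ : ℝ) / (ρ / lam : ℕ)) ^ p * N :=
        hdbl (ρ / lam) R₀ hR'1 (hR'ρ.trans hρR₀) hR₀le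
      rw [hWeq x]
      calc _ ≤ (|C| * Real.sqrt CW * (2 * lam) ^ p * Real.sqrt N * ((R₀ : ℝ) / ρ) ^ (p + q)) ^ n :=
            uniformBound_far_zone_arith hCW0.le hR'1 (Nat.lt_mul_div_succ ρ (by omega)) (hR'ρ.trans hρR₀)
              hρR₀ hρ1 hdom hAR'
        _ = (B₁ * ((R₀ : ℝ) / ρ) ^ (p + q)) ^ n := by rw [hB₁]
        _ ≤ ((B₁ + B₂) * ((R₀ : ℝ) / ρ) ^ (p + q)) ^ n :=
            pow_le_pow_left₀ (by positivity)
              (mul_le_mul_of_nonneg_right (le_add_of_nonneg_right hB₂0) (by positivity)) n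
    · -- near zone `ρ < λ`: the sup bound
      push Not at hlamρ
      refine (hWsup x).trans ?_
      rw [hB₂]
      exact uniformBound_near_zone_arith hM0 hB₁0 hρ1 hlamρ.le hR₀1 n
  -- the abstract three-zone bound, and the tail arithmetic
  have hmain := hSSB n hn S R₀ (m β) M (B₁ + B₂) W y F ha ha24 hSa hR₀1 hR₀a hSR hM0 (by positivity)
    hWsup hWsep hy hF
  exact uniformBound_tail_arith hn0 hK₀ hM0 ha.le hκ0 (by positivity) (by positivity) (by positivity)
    (schwartzNorm_nonneg _ _) hB₁ hB₂ hlamR₀ hκN hmain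

end Summit.QuantumFields.YangMills.Cruxes.HypercubicLimit.PeelAndDisseminate

end
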